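import Mathlib
import Summits.KontsevichZagierPeriods.KontsevichZagierPeriods.Theorems.SoloInformedParityFaces
import HarnessLib
import HarnessLib.Audit

/-!
# SoloInformed — block products of sub-graph solids and the log cube

Infrastructure for the length faces (`SoloInformedLengthFaces`): for sub-graph solids
`E_q = {(x,t) ∈ [0,1]ⁿ⁺¹ : t · q(x) ≤ 1}` (`q ≥ 1` on the cube, `SoloInformedSubgraph`),

* the **block product** `q₁ ⊠ q₂ := q₁(x₀,…,x_{a−1}) · q₂(x_a,…,x_{a+b−1})` of polynomials in disjoint
  variables and **`vol E_{q₁ ⊠ q₂} = vol E_{q₁} · vol E_{q₂}`** (`soloInformed_value_blockRep`, Fubini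
  over `[0,1]^{a+b} ≃ [0,1]^a × [0,1]^b` via Mathlib's `sumPiEquivProdPi` and `piCongrLeft finSumFinEquiv`);
* the **log cube** `Λ_n = E_{∏ᵢ (1 + xᵢ)}` of volume **`(log 2)ⁿ`** (`soloInformed_value_logSolid`);
* the alternating-zeta volumes `vol E_η(2) = ζ(2)/2`, `vol E_η(3) = (3/4) ζ(3)`, `vol E_η(5) = (15/16) ζ(5)`
  in the form used by the faces, and Euler's `ζ(2) = q₀ π²`, `q₀ ∈ ℚˣ` (from the tree).

Residency `solo-KontsevichZagierPeriods-informed` (PLAN.md, session s20).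
References: M. Kontsevich, D. Zagier, *Periods* (2001), §1.2.
-/

noncomputable section

open MeasureTheory Set Filter
open scoped Topology

namespace Summit.KontsevichZagierPeriods.KontsevichZagierPeriods.Theorems

open Literature.NumberTheory.Transcendental Literature.NumberTheory.Transcendental.KZ

/-! ### Irrationality up to a non-zero rational factor -/

/-- `x = q·y` with `q ∈ ℚˣ`: `x ∉ ℚ ↔ y ∉ ℚ`. -/
theorem soloInformed_irrational_congr_ratMul {x y : ℝ} (q : ℚ) (hq : q ≠ 0) (h : x = (q : ℝ) * y) :
    Irrational x ↔ Irrational y := by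
  rw [h, irrational_ratCast_mul_iff]
  exact ⟨fun h' => h'.2, fun h' => ⟨hq, h'⟩⟩

/-! ### Block products: `vol E_{q₁ ⊠ q₂} = vol E_{q₁} · vol E_{q₂}` -/

section Block

variable {a b : ℕ}

/-- Fubini for a block-separated integrand on `Fin (a + b) → ℝ` with a constant product measure. -/
theorem soloInformed_integral_pi_blockMul (μ : Measure ℝ) [SigmaFinite μ]
    (f : (Fin a → ℝ) → ℝ) (g : (Fin b → ℝ) → ℝ) :
    ∫ x, f (fun i => x (Fin.castAdd b i)) * g (fun j => x (Fin.natAdd a j))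
        ∂(Measure.pi fun _ : Fin (a + b) => μ) =
      (∫ y, f y ∂(Measure.pi fun _ : Fin a => μ)) * ∫ z, g z ∂(Measure.pi fun _ : Fin b => μ) := by
  have h₁ := measurePreserving_piCongrLeft (fun _ : Fin (a + b) => μ) finSumFinEquiv
  have h₂ := measurePreserving_sumPiEquivProdPi fun _ : Fin a ⊕ Fin b => μ
  rw [← h₁.integral_comp'
    (fun x : Fin (a + b) → ℝ => f (fun i => x (Fin.castAdd b i)) * g (fun j => x (Fin.natAdd a j)))]
  have e : ∀ y : Fin a ⊕ Fin b → ℝ,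
      f (fun i => MeasurableEquiv.piCongrLeft (fun _ : Fin (a + b) => ℝ) finSumFinEquiv y
          (Fin.castAdd b i)) *
        g (fun j => MeasurableEquiv.piCongrLeft (fun _ : Fin (a + b) => ℝ) finSumFinEquiv y
          (Fin.natAdd a j)) =
      (fun p : (Fin a → ℝ) × (Fin b → ℝ) => f p.1 * g p.2)
        (MeasurableEquiv.sumPiEquivProdPi (fun _ : Fin a ⊕ Fin b => ℝ) y) := by
    intro y
    have e₁ : ∀ i : Fin a, MeasurableEquiv.piCongrLeft (fun _ : Fin (a + b) => ℝ) finSumFinEquiv y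
        (Fin.castAdd b i) = y (Sum.inl i) := fun i => by
      rw [MeasurableEquiv.coe_piCongrLeft, ← finSumFinEquiv_apply_left, Equiv.piCongrLeft_apply_apply]
    have e₂ : ∀ j : Fin b, MeasurableEquiv.piCongrLeft (fun _ : Fin (a + b) => ℝ) finSumFinEquiv y
        (Fin.natAdd a j) = y (Sum.inr j) := fun j => by
      rw [MeasurableEquiv.coe_piCongrLeft, ← finSumFinEquiv_apply_right, Equiv.piCongrLeft_apply_apply]
    simp_rw [e₁, e₂]
    rfl
  simp_rw [e]
  rw [h₂.integral_comp' (fun p : (Fin a → ℝ) × (Fin b → ℝ) => f p.1 * g p.2)]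
  exact integral_prod_mul f g

/-- **Fubini over the cube for a block-separated integrand:**
`∫_{[0,1]^{a+b}} f(x_{<a}) g(x_{≥a}) dx = (∫_{[0,1]^a} f)(∫_{[0,1]^b} g)`. -/
theorem soloInformed_setIntegral_cube_blockMul (f : (Fin a → ℝ) → ℝ) (g : (Fin b → ℝ) → ℝ) :
    ∫ x in KZ.cube (a + b), f (fun i => x (Fin.castAdd b i)) * g (fun j => x (Fin.natAdd a j)) =
      (∫ y in KZ.cube a, f y) * ∫ z in KZ.cube b, g z := by
  simp only [KZ.cube_eq_pi, volume_pi, Measure.restrict_pi_pi]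
  exact soloInformed_integral_pi_blockMul _ f g

variable (q₁ : MvPolynomial (Fin a) ℚ) (q₂ : MvPolynomial (Fin b) ℚ)

/-- **Block product** `q₁ ⊠ q₂ := q₁(x₀,…,x_{a−1}) · q₂(x_a,…,x_{a+b−1}) ∈ ℚ[x₀,…,x_{a+b−1}]`. -/
def soloInformedBlockMul : MvPolynomial (Fin (a + b)) ℚ :=
  MvPolynomial.rename (Fin.castAdd b) q₁ * MvPolynomial.rename (Fin.natAdd a) q₂

/-- `(q₁ ⊠ q₂)(x) = q₁(x_{<a}) · q₂(x_{≥a})`. -/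
@[simp] theorem soloInformed_aeval_blockMul (x : Fin (a + b) → ℝ) :
    (MvPolynomial.aeval x (soloInformedBlockMul q₁ q₂) : ℝ) =
      MvPolynomial.aeval (fun i => x (Fin.castAdd b i)) q₁ *
        MvPolynomial.aeval (fun j => x (Fin.natAdd a j)) q₂ := by
  simp [soloInformedBlockMul, MvPolynomial.aeval_rename, Function.comp_def]

/-- The first block of a point of `[0,1]^{a+b}` lies in `[0,1]^a`. -/
theorem soloInformed_castAdd_mem_cube {x : Fin (a + b) → ℝ} (hx : x ∈ KZ.cube (a + b)) :
    (fun i => x (Fin.castAdd b i)) ∈ KZ.cube a := fun _ => hx _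

/-- The second block of a point of `[0,1]^{a+b}` lies in `[0,1]^b`. -/
theorem soloInformed_natAdd_mem_cube {x : Fin (a + b) → ℝ} (hx : x ∈ KZ.cube (a + b)) :
    (fun j => x (Fin.natAdd a j)) ∈ KZ.cube b := fun _ => hx _

/-- `q₁, q₂ ≥ 1` on their cubes `⇒ q₁ ⊠ q₂ ≥ 1` on the cube. -/
theorem soloInformed_blockMul_ge_one (h₁ : ∀ x ∈ KZ.cube a, (1 : ℝ) ≤ MvPolynomial.aeval x q₁)
    (h₂ : ∀ x ∈ KZ.cube b, (1 : ℝ) ≤ MvPolynomial.aeval x q₂) :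
    ∀ x ∈ KZ.cube (a + b), (1 : ℝ) ≤ MvPolynomial.aeval x (soloInformedBlockMul q₁ q₂) := by
  intro x hx
  rw [soloInformed_aeval_blockMul]
  have := h₁ _ (soloInformed_castAdd_mem_cube hx)
  have := h₂ _ (soloInformed_natAdd_mem_cube hx)
  nlinarith

/-- **`vol E_{q₁ ⊠ q₂} = vol E_{q₁} · vol E_{q₂}`.** -/
theorem soloInformed_value_blockRep (h₁ : ∀ x ∈ KZ.cube a, (1 : ℝ) ≤ MvPolynomial.aeval x q₁)
    (h₂ : ∀ x ∈ KZ.cube b, (1 : ℝ) ≤ MvPolynomial.aeval x q₂) :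
    (soloInformedSubgraphRep (soloInformedBlockMul q₁ q₂) (soloInformed_blockMul_ge_one q₁ q₂ h₁ h₂)).value
      = (soloInformedSubgraphRep q₁ h₁).value * (soloInformedSubgraphRep q₂ h₂).value := by
  rw [soloInformed_value_subgraphRep, soloInformed_value_subgraphRep, soloInformed_value_subgraphRep]
  simp_rw [soloInformed_aeval_blockMul, mul_inv]
  exact soloInformed_setIntegral_cube_blockMul (fun y : Fin a → ℝ => ((MvPolynomial.aeval y q₁ : ℝ))⁻¹)
    (fun z : Fin b → ℝ => ((MvPolynomial.aeval z q₂ : ℝ))⁻¹)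

end Block

/-! ### The log cube `Λ_n = E_{∏ (1 + xᵢ)}`, volume `(log 2)ⁿ` -/

variable {n : ℕ}

/-- `∏ᵢ (1 + xᵢ) ∈ ℚ[x₀, …, x_{n−1}]`. -/
def soloInformedLogPoly (n : ℕ) : MvPolynomial (Fin n) ℚ := ∏ i, (1 + MvPolynomial.X i)

/-- `(∏ᵢ (1 + xᵢ))(x) = ∏ᵢ (1 + xᵢ)`. -/
@[simp] theorem soloInformed_aeval_logPoly (x : Fin n → ℝ) :
    (MvPolynomial.aeval x (soloInformedLogPoly n) : ℝ) = ∏ i, (1 + x i) := by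
  simp [soloInformedLogPoly, map_prod]

/-- `∏ᵢ (1 + xᵢ) ≥ 1` on the cube. -/
theorem soloInformed_logPoly_ge_one (n : ℕ) :
    ∀ x ∈ KZ.cube n, (1 : ℝ) ≤ MvPolynomial.aeval x (soloInformedLogPoly n) := by
  intro x hx
  rw [soloInformed_aeval_logPoly]
  calc (1 : ℝ) = ∏ _i : Fin n, (1 : ℝ) := Finset.prod_const_one.symm
    _ ≤ ∏ i, (1 + x i) :=
      Finset.prod_le_prod (fun _ _ => zero_le_one) fun i _ => by linarith [(hx i).1]

/-- **The log cube `Λ_n = {(x, t) ∈ [0,1]ⁿ⁺¹ : t · ∏ᵢ (1 + xᵢ) ≤ 1}`.** -/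
def soloInformedLogSolid (n : ℕ) : IntegralRep (n + 1) :=
  soloInformedSubgraphRep (soloInformedLogPoly n) (soloInformed_logPoly_ge_one n)

/-- `∫₀¹ dt/(1 + t) = log 2`. -/
theorem soloInformed_integral_Icc_inv_one_add :
    ∫ t in Icc (0 : ℝ) 1, (1 + t)⁻¹ = Real.log 2 := by
  rw [integral_Icc_eq_integral_Ioc, ← intervalIntegral.integral_of_le zero_le_one,
    intervalIntegral.integral_comp_add_left (fun s : ℝ => s⁻¹) (1 : ℝ),
    show (1 : ℝ) + 0 = 1 by norm_num, show (1 : ℝ) + 1 = 2 by norm_num,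
    integral_inv_of_pos zero_lt_one zero_lt_two, div_one]

/-- **`vol Λ_n = (log 2)ⁿ`** (Fubini over the cube and `∫₀¹ dt/(1+t) = log 2`). -/
theorem soloInformed_value_logSolid (n : ℕ) : (soloInformedLogSolid n).value = Real.log 2 ^ n := by
  rw [soloInformedLogSolid, soloInformed_value_subgraphRep]
  have e : ∀ x : Fin n → ℝ, ((MvPolynomial.aeval x (soloInformedLogPoly n) : ℝ))⁻¹ =
      ∏ i, (fun t : ℝ => (1 + t)⁻¹) (x i) := fun x => by
    rw [soloInformed_aeval_logPoly, ← Finset.prod_inv_distrib]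
  simp_rw [e]
  rw [KZ.cube_eq_pi, volume_pi, Measure.restrict_pi_pi,
    integral_fintype_prod_eq_pow (fun t : ℝ => (1 + t)⁻¹), Fintype.card_fin,
    soloInformed_integral_Icc_inv_one_add]

/-! ### The alternating-zeta values `η(2) = ζ(2)/2 = π²/12`, `η(3) = (3/4) ζ(3)`, `η(5) = (15/16) ζ(5)` -/

/-- `vol E_η(2) = ζ(2)/2` (`= π²/12`). -/
theorem soloInformed_value_etaSolid_two :
    (soloInformedSubgraphRep (soloInformedEtaPoly 2) (soloInformed_etaPoly_ge_one 2)).value =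
      ((1 / 2 : ℚ) : ℝ) * zetaValue 2 := by
  rw [show (soloInformedSubgraphRep (soloInformedEtaPoly 2) (soloInformed_etaPoly_ge_one 2)).value =
      (1 - 2 / 2 ^ 2) * zetaValue 2 from soloInformed_value_etaSolid (n := 2) le_rfl]
  push_cast
  norm_num

/-- `vol E_η(3) = (3/4) ζ(3)`. -/
theorem soloInformed_value_etaSolid_three :
    (soloInformedSubgraphRep (soloInformedEtaPoly 3) (soloInformed_etaPoly_ge_one 3)).value =
      ((3 / 4 : ℚ) : ℝ) * zetaValue 3 := by
  rw [show (soloInformedSubgraphRep (soloInformedEtaPoly 3) (soloInformed_etaPoly_ge_one 3)).value =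
      (1 - 2 / 2 ^ 3) * zetaValue 3 from soloInformed_value_etaSolid (n := 3) (by norm_num)]
  push_cast
  norm_num

/-- `vol E_η(5) = (15/16) ζ(5)`. -/
theorem soloInformed_value_etaSolid_five :
    (soloInformedSubgraphRep (soloInformedEtaPoly 5) (soloInformed_etaPoly_ge_one 5)).value =
      ((15 / 16 : ℚ) : ℝ) * zetaValue 5 := by
  rw [show (soloInformedSubgraphRep (soloInformedEtaPoly 5) (soloInformed_etaPoly_ge_one 5)).value =
      (1 - 2 / 2 ^ 5) * zetaValue 5 from soloInformed_value_etaSolid (n := 5) (by norm_num)]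
  push_cast
  norm_num

/-- Euler: `ζ(2) = q₀ π²` with `q₀ ∈ ℚˣ` (the tree's `exists_rat_ne_zero_zetaValue_two_mul_eq`). -/
theorem soloInformed_exists_rat_zetaValue_two :
    ∃ q : ℚ, q ≠ 0 ∧ zetaValue 2 = (q : ℝ) * Real.pi ^ 2 := by
  obtain ⟨q, hq0, hq⟩ :=
    Literature.Barriers.KontsevichZagierPeriods.exists_rat_ne_zero_zetaValue_two_mul_eq (k := 1) one_ne_zero
  exact ⟨q, hq0, by simpa using hq⟩

end Summit.KontsevichZagierPeriods.KontsevichZagierPeriods.Theorems
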